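import Literature.NumberTheory.NumberFields.CyclicCubicField13Descent
import Literature.Barriers.BirchSwinnertonDyer.RankNotSumOfLocalInvariantsF3NormDescentProofs
import Literature.Barriers.BirchSwinnertonDyer.RankNotSumOfLocalInvariantsF3CubicRoots
import Literature.Barriers.BirchSwinnertonDyer.RankNotSumOfLocalInvariants480a1
import HarnessLib

/-!
# Barrier (BirchSwinnertonDyer), rank mod `3`: the conductor-`13` descent, and what remains

Proofs continuing `RankNotSumOfLocalInvariantsF3NormDescentProofs.lean` towards the named fact
`Literature.Barriers.BirchSwinnertonDyer.DokchitserDokchitser2011_rank_480a1_F3`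
(`rk E(F₃) = 1` for `E = 480a1 : y² = x(x+2)(x-3)` over the degree-`9` field `F₃ ⊂ ℚ(ζ₁₃, ζ₁₀₃)` of
T. Dokchitser–V. Dokchitser, *A note on the Mordell–Weil rank modulo `n`*, J. Number Theory 131
(2011), proof of Thm. 2: "2-descent shows that `rk E/F₃ = 1` (e.g. using Magma, over all minimal
non-trivial subfields of `F_n`)"). By `DokchitserDokchitser2011_rank_480a1_F3_of_cubic_normDescent`
the fact follows from the norm-`1` `2`-descent statement over each of the four cubic subfields
`K_σ ⊂ F₃` (conductors `13`, `103`, `1339`, `1339`). Here: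

* `curve480a1.normDescent_of_root13`, `curve480a1.mordellWeilRank_baseChange_eq_one_of_root13`:
  the FIRST of the four descents, done — over every cubic extension `K/ℚ` containing a root of
  `f₁₃ = X³ + X² - 4X + 1` the norm-`1` descent statement holds
  (`Literature.NumberTheory.NumberFields.CyclicCubic13.normDescent_of_root`, the explicit
  `2`-descent of `Literature/NumberTheory/NumberFields/CyclicCubicField13Descent.lean`), hence
  `rk E(K) = 1` for every Galois cubic number field `K ∋ θ`, `f₁₃(θ) = 0` (in particular the
  hypothesis `h13` of `DokchitserDokchitser2011.descent_480a1_F3_cubic_of_cubics` is discharged: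
  `curve480a1.mordellWeilRank_baseChange_le_one_of_root13`);
* `DokchitserDokchitser2011_rank_480a1_F3_of_normDescent_103_1339`: CONSEQUENTLY the named fact
  follows from the norm-`1` descent statements for the three remaining cubics
  `f₁₀₃ = X³ + X² - 34X - 61`, `f' = X³ + X² - 446X + 248`, `f'' = X³ + X² - 446X - 3769`
  (each `K_σ` contains a root of one of the four, `F₃.exists_root_mem_cubicField`). These three
  statements are hypotheses of the theorem, not named facts.

## References

* T. Dokchitser, V. Dokchitser, *A note on the Mordell–Weil rank modulo `n`*, J. Number Theory 131
  (2011) 1833–1839, arXiv:0910.4588: proof of Thm. 2. [DokchitserDokchitser2011RankModN]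
* J. H. Silverman, *The Arithmetic of Elliptic Curves*, 2nd ed., GTM 106 (2009): Prop. X.1.4
  (complete `2`-descent). [SilvermanAEC2009]
-/

noncomputable section

open scoped NumberField

open NumberField WeierstrassCurve IntermediateField

namespace Literature.Barriers.BirchSwinnertonDyer

open Literature.NumberTheory.NumberFields

namespace curve480a1

/-- A point `(x, y)` of `480a1` over a field `K ⊇ ℚ` with `x ≠ 0, -2, 3` satisfies
`y² = x(x+2)(x-3)` with `y ≠ 0`. [folklore] -/
theorem eq_and_ne_of_nonsingular (K : Type) [Field K] [Algebra ℚ K] {x y : K}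
    (h : (curve480a1.baseChange K).toAffine.Nonsingular x y) (h0 : x ≠ 0) (h2 : x ≠ -2)
    (h3 : x ≠ 3) : y ^ 2 = x * (x + 2) * (x - 3) ∧ y ≠ 0 := by
  have hE : y ^ 2 = x ^ 3 - x ^ 2 - 6 * x := (curve480a1.nonsingular_iff K x y).mp h
  refine ⟨by rw [hE]; ring, fun hy => ?_⟩
  rw [hy] at hE
  have hx : x * ((x + 2) * (x - 3)) = 0 := by linear_combination -hE
  rcases mul_eq_zero.mp hx with h' | h'
  · exact h0 h'
  rcases mul_eq_zero.mp h' with h'' | h''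
  · exact h2 (by linear_combination h'')
  · exact h3 (by linear_combination h'')

/-- **The norm-`1` `2`-descent of `480a1` over the cubic field of conductor `13`, in every
presentation.** For a cubic extension `K/ℚ` containing a root `θ` of `f₁₃ = X³ + X² - 4X + 1`
and a point `(x, y) ∈ E(K)`, `x ≠ 0, -2, 3`: if `N_{K/ℚ}(x)` and `N_{K/ℚ}(x + 2)` are rational
squares then `x`, `x + 2` are squares in `K`
(`CyclicCubic13.normDescent_of_root`). [cite: DokchitserDokchitser2011RankModN, proof of Thm. 2] -/
theorem normDescent_of_root13 (K : Type) [Field K] [Algebra ℚ K] (h3 : Module.finrank ℚ K = 3)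
    {θ : K} (hθ : θ ^ 3 + θ ^ 2 - 4 * θ + 1 = 0) :
    ∀ x y : K, (curve480a1.baseChange K).toAffine.Nonsingular x y →
      x ≠ 0 → x ≠ -2 → x ≠ 3 → IsSquare (Algebra.norm ℚ x) → IsSquare (Algebra.norm ℚ (x + 2)) →
      IsSquare x ∧ IsSquare (x + 2) := fun _ _ hxy h0 h2 h3' hN hN2 =>
  have hpt := eq_and_ne_of_nonsingular K hxy h0 h2 h3'
  CyclicCubic13.normDescent_of_root h3 hθ hpt.1 hpt.2 hN hN2

/-- **`rk E(K) = 1` for `E = 480a1` over every Galois cubic number field containing a root of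
`f₁₃`** (the conductor-`13` case of "2-descent […] over all minimal non-trivial subfields of
`F₃`"; `rk E(ℚ) = 1` is `curve480a1.mordellWeilRank_eq_one`).
[cite: DokchitserDokchitser2011RankModN, proof of Thm. 2] -/
theorem mordellWeilRank_baseChange_eq_one_of_root13 (K : Type) [Field K] [NumberField K]
    [Algebra ℚ K] [IsGalois ℚ K] (h3 : Module.finrank ℚ K = 3) {θ : K}
    (hθ : θ ^ 3 + θ ^ 2 - 4 * θ + 1 = 0) : (curve480a1.baseChange K).mordellWeilRank = 1 :=
  mordellWeilRank_baseChange_eq_one_of_odd_of_normDescent K (by rw [h3]; exact ⟨1, rfl⟩)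
    (normDescent_of_root13 K h3 hθ)

/-- The same as a rank BOUND, in the shape of hypothesis `h13` of
`DokchitserDokchitser2011.descent_480a1_F3_cubic_of_cubics`. [cite: DokchitserDokchitser2011RankModN, proof of Thm. 2] -/
theorem mordellWeilRank_baseChange_le_one_of_root13 :
    ∀ (K : Type) [Field K] [NumberField K] [IsGalois ℚ K],
      Module.finrank ℚ K = 3 → ∀ θ : K, θ ^ 3 + θ ^ 2 - 4 * θ + 1 = 0 →
        (curve480a1.baseChange K).mordellWeilRank ≤ 1 :=
  fun K _ _ _ h3 _ hθ => (mordellWeilRank_baseChange_eq_one_of_root13 K h3 hθ).le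

end curve480a1

namespace DokchitserDokchitser2011

open Cyclotomic1339

/-- **The conductor-`13` instances of the cubic norm descent over `F₃`.** For `σ ∈ Gal(F₃/ℚ)`,
`σ ≠ 1`, such that `K_σ = F₃^{⟨σ⟩}` contains a root of `f₁₃` (i.e. `K_σ` is the conductor-`13`
subfield), the norm-`1` descent statement over `K_σ` holds. [cite: DokchitserDokchitser2011RankModN, proof of Thm. 2] -/
theorem F₃.normDescent_cubicField_of_root13 {σ : Gal(F₃/ℚ)} (hσ : σ ≠ 1) {θ : F₃.cubicField σ}
    (hθ : θ ^ 3 + θ ^ 2 - 4 * θ + 1 = 0) :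
    ∀ x y : F₃.cubicField σ,
      (curve480a1.baseChange (F₃.cubicField σ)).toAffine.Nonsingular x y →
      x ≠ 0 → x ≠ -2 → x ≠ 3 → IsSquare (Algebra.norm ℚ x) → IsSquare (Algebra.norm ℚ (x + 2)) →
      IsSquare x ∧ IsSquare (x + 2) :=
  curve480a1.normDescent_of_root13 (F₃.cubicField σ) (F₃.finrank_cubicField hσ) hθ

end DokchitserDokchitser2011

open DokchitserDokchitser2011 in
/-- **What remains of the `n = 3` fact after the conductor-`13` descent.** The named fact
`DokchitserDokchitser2011_rank_480a1_F3` follows from the norm-`1` `2`-descent statements of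
`480a1` over the cubic extensions of `ℚ` generated by a root of `f₁₀₃ = X³ + X² - 34X - 61`, of
`f' = X³ + X² - 446X + 248` and of `f'' = X³ + X² - 446X - 3769` (the cyclic cubic fields of
conductor `103`, `1339`, `1339`): each cubic subfield `K_σ ⊂ F₃` contains a root of one of
`f₁₃, f₁₀₃, f', f''` (`F₃.exists_root_mem_cubicField`), and the `f₁₃` case is
`curve480a1.normDescent_of_root13`. [cite: DokchitserDokchitser2011RankModN, proof of Thm. 2] -/
theorem DokchitserDokchitser2011_rank_480a1_F3_of_normDescent_103_1339
    (h103 : ∀ (K : Type) [Field K] [Algebra ℚ K], Module.finrank ℚ K = 3 →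
      ∀ θ : K, θ ^ 3 + θ ^ 2 - 34 * θ - 61 = 0 → ∀ x y : K, y ^ 2 = x * (x + 2) * (x - 3) →
        y ≠ 0 → IsSquare (Algebra.norm ℚ x) → IsSquare (Algebra.norm ℚ (x + 2)) →
        IsSquare x ∧ IsSquare (x + 2))
    (h1339a : ∀ (K : Type) [Field K] [Algebra ℚ K], Module.finrank ℚ K = 3 →
      ∀ θ : K, θ ^ 3 + θ ^ 2 - 446 * θ + 248 = 0 → ∀ x y : K, y ^ 2 = x * (x + 2) * (x - 3) →
        y ≠ 0 → IsSquare (Algebra.norm ℚ x) → IsSquare (Algebra.norm ℚ (x + 2)) →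
        IsSquare x ∧ IsSquare (x + 2))
    (h1339b : ∀ (K : Type) [Field K] [Algebra ℚ K], Module.finrank ℚ K = 3 →
      ∀ θ : K, θ ^ 3 + θ ^ 2 - 446 * θ - 3769 = 0 → ∀ x y : K, y ^ 2 = x * (x + 2) * (x - 3) →
        y ≠ 0 → IsSquare (Algebra.norm ℚ x) → IsSquare (Algebra.norm ℚ (x + 2)) →
        IsSquare x ∧ IsSquare (x + 2)) :
    DokchitserDokchitser2011_rank_480a1_F3 := by
  refine DokchitserDokchitser2011_rank_480a1_F3_of_cubic_normDescent fun σ hσ => ?_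
  have hdeg := F₃.finrank_cubicField hσ
  rcases F₃.exists_root_mem_cubicField σ with ⟨θ, hθ⟩ | ⟨θ, hθ⟩ | ⟨θ, hθ⟩ | ⟨θ, hθ⟩
  · exact F₃.normDescent_cubicField_of_root13 hσ hθ
  · intro x y hxy h0 h2 h3 hN hN2
    have hpt := curve480a1.eq_and_ne_of_nonsingular _ hxy h0 h2 h3
    exact h103 _ hdeg θ hθ x y hpt.1 hpt.2 hN hN2
  · intro x y hxy h0 h2 h3 hN hN2
    have hpt := curve480a1.eq_and_ne_of_nonsingular _ hxy h0 h2 h3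
    exact h1339a _ hdeg θ hθ x y hpt.1 hpt.2 hN hN2
  · intro x y hxy h0 h2 h3 hN hN2
    have hpt := curve480a1.eq_and_ne_of_nonsingular _ hxy h0 h2 h3
    exact h1339b _ hdeg θ hθ x y hpt.1 hpt.2 hN hN2

end Literature.Barriers.BirchSwinnertonDyer

end
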